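import Literature.MathematicalPhysics.QuantumLattice.HubbardTTPrimeMultilinearBoxWordAdapters
import Literature.MathematicalPhysics.QuantumLattice.HubbardNNNHoppingEnergyDensityParticleHole
import HarnessLib

/-!
# The PARTICLE–HOLE IMAGE of a box word is a MULTILINEAR box word: `(U, t', n) ↦ (U, −t', 2 − n)`
# carries affine / multilinear words across half filling, with the exact bilinear shift `U·(n − 1)`

Family `hubbard` (topic `MathematicalPhysics/QuantumLattice`), companion of
`HubbardTTPrimeMultilinearBoxWordAdapters` (the eight-coefficient `_mlword_Icc` shape on
`Set.Icc ![U₁,s₁,n₁] ![U₂,s₂,n₂]`, `θ 0 = U/t`, `θ 1 = t'/t`, `θ 2 = n`) and of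
`HubbardNNNHoppingEnergyDensityParticleHole` (`energyDensityTT'_particleHole`:
`e(t, t', U, n) = e(t, −t', U, 2 − n) + U(n − 1)` for `U ≥ 0`, `0 < n < 2`; Lieb–Wu 2003 §1 (3)).
The particle–hole map sends the cell `[U₁,U₂] × [s₁,s₂] × [n₁,n₂]` onto the IMAGE cell
`[U₁,U₂] × [−s₂,−s₁] × [2−n₂, 2−n₁]`; a multilinear word certified on the image cell is therefore a
multilinear word on the original cell — the substitution `(θ1, θ2) ↦ (−θ1, 2 − θ2)` keeps the monomial
span, and the shift `U(n − 1) = θ0·θ2 − θ0` is itself bilinear. Coefficient map (floor and cap alike):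

  `(c₀, c₁, c₂, c₃, c₄, c₅, c₆, c₇) ↦ (c₀ + 2c₃, c₁ + 2c₅ − 1, −c₂ − 2c₆, −c₃, −c₄ − 2c₇, 1 − c₅, c₆, c₇)`.

* `mlFloor_Icc₃_phImage`, `mlCap_Icc₃_phImage`, `mlword_Icc₃_phImage` — multilinear in, multilinear out;
* `mlword_of_affword_phImage_Icc₃` — an AFFINE word on the image cell gives the multilinear word with
  the single mixed monomial `θ0·θ2` (coefficient `1`) on the original cell: the kernel form of the
  surrogate's «PH image of affine words as exact multilinear words» (f3hub 0.5.28), and the route by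
  which hole-side atlas words (`n ≤ 1`) word the electron side / the slab above half filling
  (`n ∈ [1, 2 − n₁]`), to be read back as constants or affine words by `constWord_of_mlword_Icc₃` /
  `affword_of_mlword_Icc₃`.

Everything is `linear_combination` over the particle–hole identity; no definition, no number.
WHAT THIS IS NOT: a bound at any anchor; a statement at `U < 0` or at `n ∉ (0, 2)`.

## References

* E. H. Lieb, F. Y. Wu, *The one-dimensional Hubbard model: a reminiscence*, Physica A 321 (2003),
  §1 eq. (3) (particle–hole transformation of the Hubbard Hamiltonian). [cite: LiebWuPhysicaA2003, §1 eq. (3)]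
* A. D. Rikun, J. Global Optim. 10 (1997) 425–437 (multilinear words are vertex-polyhedral).
  [cite: Rikun1997MultilinearEnvelope, Thm 1.1]
-/

noncomputable section

namespace Literature.MathematicalPhysics.QuantumLattice

namespace ThermodynamicLimit

open Set

/-- The particle–hole image point `(U, −t', 2 − n)` of a point of `[U₁,U₂] × [s₁,s₂] × [n₁,n₂]` lies in
the image cell `[U₁,U₂] × [−s₂,−s₁] × [2−n₂, 2−n₁]`. [cite: LiebWuPhysicaA2003, §1 eq. (3)] -/
theorem phImage_mem_Icc₃ {U₁ U₂ s₁ s₂ n₁ n₂ : ℝ} {θ : Fin 3 → ℝ}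
    (hθ : θ ∈ Set.Icc (![U₁, s₁, n₁] : Fin 3 → ℝ) ![U₂, s₂, n₂]) :
    (![θ 0, -θ 1, 2 - θ 2] : Fin 3 → ℝ) ∈ Set.Icc (![U₁, -s₂, 2 - n₂] : Fin 3 → ℝ) ![U₂, -s₁, 2 - n₁] := by
  obtain ⟨⟨k1, k2⟩, ⟨k3, k4⟩, ⟨k5, k6⟩⟩ := mem_Icc_vec3_iff.1 hθ
  refine mem_Icc_vec3_iff.2 ?_
  simp only [Matrix.cons_val_zero, Matrix.cons_val_one, Matrix.cons_val]
  exact ⟨⟨k1, k2⟩, ⟨by linarith, by linarith⟩, ⟨by linarith, by linarith⟩⟩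

/-- **Particle–hole image of a multilinear FLOOR.** A multilinear floor certified on the IMAGE cell
`[U₁,U₂] × [−s₂,−s₁] × [2−n₂, 2−n₁]` is the multilinear floor with coefficients
`(c₀ + 2c₃, c₁ + 2c₅ − 1, −c₂ − 2c₆, −c₃, −c₄ − 2c₇, 1 − c₅, c₆, c₇)` on `[U₁,U₂] × [s₁,s₂] × [n₁,n₂]`
(`0 ≤ U₁`, `0 < n₁`, `n₂ < 2`). [cite: LiebWuPhysicaA2003, §1 eq. (3)] -/
theorem mlFloor_Icc₃_phImage (t : ℝ) {U₁ U₂ s₁ s₂ n₁ n₂ c₀ c₁ c₂ c₃ c₄ c₅ c₆ c₇ : ℝ}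
    (hU₁ : 0 ≤ U₁) (hn₁ : 0 < n₁) (hn₂ : n₂ < 2)
    (h : ∀ θ ∈ Set.Icc (![U₁, -s₂, 2 - n₂] : Fin 3 → ℝ) ![U₂, -s₁, 2 - n₁],
      c₀ + c₁ * θ 0 + c₂ * θ 1 + c₃ * θ 2 + c₄ * θ 0 * θ 1 + c₅ * θ 0 * θ 2 + c₆ * θ 1 * θ 2 +
        c₇ * θ 0 * θ 1 * θ 2 ≤ energyDensityTT' t (θ 1) (θ 0) (θ 2)) :
    ∀ θ ∈ Set.Icc (![U₁, s₁, n₁] : Fin 3 → ℝ) ![U₂, s₂, n₂],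
      (c₀ + 2 * c₃) + (c₁ + 2 * c₅ - 1) * θ 0 + (-c₂ - 2 * c₆) * θ 1 + (-c₃) * θ 2 +
        (-c₄ - 2 * c₇) * θ 0 * θ 1 + (1 - c₅) * θ 0 * θ 2 + c₆ * θ 1 * θ 2 + c₇ * θ 0 * θ 1 * θ 2 ≤
        energyDensityTT' t (θ 1) (θ 0) (θ 2) := by
  intro θ hθ
  obtain ⟨⟨k1, _⟩, _, ⟨k5, k6⟩⟩ := mem_Icc_vec3_iff.1 hθ
  have hi := h _ (phImage_mem_Icc₃ hθ)
  simp only [Matrix.cons_val_zero, Matrix.cons_val_one, Matrix.cons_val] at hi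
  rw [energyDensityTT'_particleHole t (θ 1) (hU₁.trans k1) (hn₁.trans_le k5) (lt_of_le_of_lt k6 hn₂)]
  linear_combination hi

/-- **Particle–hole image of a multilinear CAP** (same coefficient map).
[cite: LiebWuPhysicaA2003, §1 eq. (3)] -/
theorem mlCap_Icc₃_phImage (t : ℝ) {U₁ U₂ s₁ s₂ n₁ n₂ d₀ d₁ d₂ d₃ d₄ d₅ d₆ d₇ : ℝ}
    (hU₁ : 0 ≤ U₁) (hn₁ : 0 < n₁) (hn₂ : n₂ < 2)
    (h : ∀ θ ∈ Set.Icc (![U₁, -s₂, 2 - n₂] : Fin 3 → ℝ) ![U₂, -s₁, 2 - n₁],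
      energyDensityTT' t (θ 1) (θ 0) (θ 2) ≤ d₀ + d₁ * θ 0 + d₂ * θ 1 + d₃ * θ 2 + d₄ * θ 0 * θ 1 +
        d₅ * θ 0 * θ 2 + d₆ * θ 1 * θ 2 + d₇ * θ 0 * θ 1 * θ 2) :
    ∀ θ ∈ Set.Icc (![U₁, s₁, n₁] : Fin 3 → ℝ) ![U₂, s₂, n₂],
      energyDensityTT' t (θ 1) (θ 0) (θ 2) ≤
        (d₀ + 2 * d₃) + (d₁ + 2 * d₅ - 1) * θ 0 + (-d₂ - 2 * d₆) * θ 1 + (-d₃) * θ 2 +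
        (-d₄ - 2 * d₇) * θ 0 * θ 1 + (1 - d₅) * θ 0 * θ 2 + d₆ * θ 1 * θ 2 + d₇ * θ 0 * θ 1 * θ 2 := by
  intro θ hθ
  obtain ⟨⟨k1, _⟩, _, ⟨k5, k6⟩⟩ := mem_Icc_vec3_iff.1 hθ
  have hi := h _ (phImage_mem_Icc₃ hθ)
  simp only [Matrix.cons_val_zero, Matrix.cons_val_one, Matrix.cons_val] at hi
  rw [energyDensityTT'_particleHole t (θ 1) (hU₁.trans k1) (hn₁.trans_le k5) (lt_of_le_of_lt k6 hn₂)]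
  linear_combination hi

/-- **Particle–hole image of a two-sided multilinear word** (`_mlword_Icc` in, `_mlword_Icc` out).
[cite: LiebWuPhysicaA2003, §1 eq. (3)] -/
theorem mlword_Icc₃_phImage (t : ℝ) {U₁ U₂ s₁ s₂ n₁ n₂ c₀ c₁ c₂ c₃ c₄ c₅ c₆ c₇
    d₀ d₁ d₂ d₃ d₄ d₅ d₆ d₇ : ℝ} (hU₁ : 0 ≤ U₁) (hn₁ : 0 < n₁) (hn₂ : n₂ < 2)
    (h : ∀ θ ∈ Set.Icc (![U₁, -s₂, 2 - n₂] : Fin 3 → ℝ) ![U₂, -s₁, 2 - n₁],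
      c₀ + c₁ * θ 0 + c₂ * θ 1 + c₃ * θ 2 + c₄ * θ 0 * θ 1 + c₅ * θ 0 * θ 2 + c₆ * θ 1 * θ 2 +
          c₇ * θ 0 * θ 1 * θ 2 ≤ energyDensityTT' t (θ 1) (θ 0) (θ 2) ∧
        energyDensityTT' t (θ 1) (θ 0) (θ 2) ≤ d₀ + d₁ * θ 0 + d₂ * θ 1 + d₃ * θ 2 + d₄ * θ 0 * θ 1 +
          d₅ * θ 0 * θ 2 + d₆ * θ 1 * θ 2 + d₇ * θ 0 * θ 1 * θ 2) :
    ∀ θ ∈ Set.Icc (![U₁, s₁, n₁] : Fin 3 → ℝ) ![U₂, s₂, n₂],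
      (c₀ + 2 * c₃) + (c₁ + 2 * c₅ - 1) * θ 0 + (-c₂ - 2 * c₆) * θ 1 + (-c₃) * θ 2 +
          (-c₄ - 2 * c₇) * θ 0 * θ 1 + (1 - c₅) * θ 0 * θ 2 + c₆ * θ 1 * θ 2 + c₇ * θ 0 * θ 1 * θ 2 ≤
          energyDensityTT' t (θ 1) (θ 0) (θ 2) ∧
        energyDensityTT' t (θ 1) (θ 0) (θ 2) ≤
          (d₀ + 2 * d₃) + (d₁ + 2 * d₅ - 1) * θ 0 + (-d₂ - 2 * d₆) * θ 1 + (-d₃) * θ 2 +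
          (-d₄ - 2 * d₇) * θ 0 * θ 1 + (1 - d₅) * θ 0 * θ 2 + d₆ * θ 1 * θ 2 + d₇ * θ 0 * θ 1 * θ 2 :=
  fun θ hθ =>
    ⟨mlFloor_Icc₃_phImage t hU₁ hn₁ hn₂ (fun θ' hθ' => (h θ' hθ').1) θ hθ,
      mlCap_Icc₃_phImage t hU₁ hn₁ hn₂ (fun θ' hθ' => (h θ' hθ').2) θ hθ⟩

/-- **Particle–hole image of an AFFINE word is a multilinear word** with the single mixed monomial
`θ0·θ2` (coefficient `1`, from the shift `U(n − 1)`): an affine word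
`L₀ + L₁U + L₂t' + L₃n ≤ e ≤ H₀ + H₁U + H₂t' + H₃n` on the image cell `[U₁,U₂] × [−s₂,−s₁] × [2−n₂,2−n₁]`
gives, on `[U₁,U₂] × [s₁,s₂] × [n₁,n₂]` (`0 ≤ U₁`, `0 < n₁`, `n₂ < 2`), the `_mlword_Icc`-shaped word
with floor coefficients `(L₀ + 2L₃, L₁ − 1, −L₂, −L₃, 0, 1, 0, 0)` and cap coefficients
`(H₀ + 2H₃, H₁ − 1, −H₂, −H₃, 0, 1, 0, 0)`. [cite: LiebWuPhysicaA2003, §1 eq. (3)] -/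
theorem mlword_of_affword_phImage_Icc₃ (t : ℝ) {U₁ U₂ s₁ s₂ n₁ n₂ L₀ L₁ L₂ L₃ H₀ H₁ H₂ H₃ : ℝ}
    (hU₁ : 0 ≤ U₁) (hn₁ : 0 < n₁) (hn₂ : n₂ < 2)
    (h : ∀ θ ∈ Set.Icc (![U₁, -s₂, 2 - n₂] : Fin 3 → ℝ) ![U₂, -s₁, 2 - n₁],
      L₀ + L₁ * θ 0 + L₂ * θ 1 + L₃ * θ 2 ≤ energyDensityTT' t (θ 1) (θ 0) (θ 2) ∧
        energyDensityTT' t (θ 1) (θ 0) (θ 2) ≤ H₀ + H₁ * θ 0 + H₂ * θ 1 + H₃ * θ 2) :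
    ∀ θ ∈ Set.Icc (![U₁, s₁, n₁] : Fin 3 → ℝ) ![U₂, s₂, n₂],
      (L₀ + 2 * L₃) + (L₁ - 1) * θ 0 + (-L₂) * θ 1 + (-L₃) * θ 2 + 0 * θ 0 * θ 1 + 1 * θ 0 * θ 2 +
          0 * θ 1 * θ 2 + 0 * θ 0 * θ 1 * θ 2 ≤ energyDensityTT' t (θ 1) (θ 0) (θ 2) ∧
        energyDensityTT' t (θ 1) (θ 0) (θ 2) ≤ (H₀ + 2 * H₃) + (H₁ - 1) * θ 0 + (-H₂) * θ 1 + (-H₃) * θ 2 +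
          0 * θ 0 * θ 1 + 1 * θ 0 * θ 2 + 0 * θ 1 * θ 2 + 0 * θ 0 * θ 1 * θ 2 := by
  intro θ hθ
  have hw := mlword_Icc₃_phImage t hU₁ hn₁ hn₂ (mlword_of_affword_Icc₃ t h) θ hθ
  constructor
  · linear_combination hw.1
  · linear_combination hw.2

/-- **Particle–hole image read back as a CONSTANT window.** An affine word on the image cell and
constants `F`, `C` with `F ≤` (image floor read at the original cell's eight vertices, shifted by
`U(n−1)`) and `C ≥` (likewise for the cap) give `F ≤ e ≤ C` on `[U₁,U₂] × [s₁,s₂] × [n₁,n₂]`: the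
composition `constWord_of_mlword_Icc₃ ∘ mlword_of_affword_phImage_Icc₃`, vertex checks spelled in the
image word's own coefficients (vertex `(u, s, m)` reads `L₀ + L₁u − L₂s + L₃(2−m) + u(m−1)`).
[cite: Rikun1997MultilinearEnvelope, Thm 1.1] -/
theorem constWord_of_affword_phImage_Icc₃ (t : ℝ) {U₁ U₂ s₁ s₂ n₁ n₂ L₀ L₁ L₂ L₃ H₀ H₁ H₂ H₃ F C : ℝ}
    (hU₁ : 0 ≤ U₁) (hn₁ : 0 < n₁) (hn₂ : n₂ < 2)
    (h : ∀ θ ∈ Set.Icc (![U₁, -s₂, 2 - n₂] : Fin 3 → ℝ) ![U₂, -s₁, 2 - n₁],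
      L₀ + L₁ * θ 0 + L₂ * θ 1 + L₃ * θ 2 ≤ energyDensityTT' t (θ 1) (θ 0) (θ 2) ∧
        energyDensityTT' t (θ 1) (θ 0) (θ 2) ≤ H₀ + H₁ * θ 0 + H₂ * θ 1 + H₃ * θ 2)
    (f₁₁₁ : F ≤ L₀ + L₁ * U₁ - L₂ * s₁ + L₃ * (2 - n₁) + U₁ * (n₁ - 1))
    (f₁₁₂ : F ≤ L₀ + L₁ * U₁ - L₂ * s₁ + L₃ * (2 - n₂) + U₁ * (n₂ - 1))
    (f₁₂₁ : F ≤ L₀ + L₁ * U₁ - L₂ * s₂ + L₃ * (2 - n₁) + U₁ * (n₁ - 1))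
    (f₁₂₂ : F ≤ L₀ + L₁ * U₁ - L₂ * s₂ + L₃ * (2 - n₂) + U₁ * (n₂ - 1))
    (f₂₁₁ : F ≤ L₀ + L₁ * U₂ - L₂ * s₁ + L₃ * (2 - n₁) + U₂ * (n₁ - 1))
    (f₂₁₂ : F ≤ L₀ + L₁ * U₂ - L₂ * s₁ + L₃ * (2 - n₂) + U₂ * (n₂ - 1))
    (f₂₂₁ : F ≤ L₀ + L₁ * U₂ - L₂ * s₂ + L₃ * (2 - n₁) + U₂ * (n₁ - 1))
    (f₂₂₂ : F ≤ L₀ + L₁ * U₂ - L₂ * s₂ + L₃ * (2 - n₂) + U₂ * (n₂ - 1))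
    (g₁₁₁ : H₀ + H₁ * U₁ - H₂ * s₁ + H₃ * (2 - n₁) + U₁ * (n₁ - 1) ≤ C)
    (g₁₁₂ : H₀ + H₁ * U₁ - H₂ * s₁ + H₃ * (2 - n₂) + U₁ * (n₂ - 1) ≤ C)
    (g₁₂₁ : H₀ + H₁ * U₁ - H₂ * s₂ + H₃ * (2 - n₁) + U₁ * (n₁ - 1) ≤ C)
    (g₁₂₂ : H₀ + H₁ * U₁ - H₂ * s₂ + H₃ * (2 - n₂) + U₁ * (n₂ - 1) ≤ C)
    (g₂₁₁ : H₀ + H₁ * U₂ - H₂ * s₁ + H₃ * (2 - n₁) + U₂ * (n₁ - 1) ≤ C)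
    (g₂₁₂ : H₀ + H₁ * U₂ - H₂ * s₁ + H₃ * (2 - n₂) + U₂ * (n₂ - 1) ≤ C)
    (g₂₂₁ : H₀ + H₁ * U₂ - H₂ * s₂ + H₃ * (2 - n₁) + U₂ * (n₁ - 1) ≤ C)
    (g₂₂₂ : H₀ + H₁ * U₂ - H₂ * s₂ + H₃ * (2 - n₂) + U₂ * (n₂ - 1) ≤ C) :
    ∀ θ ∈ Set.Icc (![U₁, s₁, n₁] : Fin 3 → ℝ) ![U₂, s₂, n₂],
      F ≤ energyDensityTT' t (θ 1) (θ 0) (θ 2) ∧ energyDensityTT' t (θ 1) (θ 0) (θ 2) ≤ C :=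
  constWord_of_mlword_Icc₃ t (mlword_of_affword_phImage_Icc₃ t hU₁ hn₁ hn₂ h)
    (by linear_combination f₁₁₁) (by linear_combination f₁₁₂) (by linear_combination f₁₂₁)
    (by linear_combination f₁₂₂) (by linear_combination f₂₁₁) (by linear_combination f₂₁₂)
    (by linear_combination f₂₂₁) (by linear_combination f₂₂₂) (by linear_combination g₁₁₁)
    (by linear_combination g₁₁₂) (by linear_combination g₁₂₁) (by linear_combination g₁₂₂)
    (by linear_combination g₂₁₁) (by linear_combination g₂₁₂) (by linear_combination g₂₂₁)
    (by linear_combination g₂₂₂)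

end ThermodynamicLimit

end Literature.MathematicalPhysics.QuantumLattice
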